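import Mathlib
import Summits.ValiantsHypothesis.ValiantsHypothesis.Theorems.KPlusLogSqLawStepPair

/-!
# The STEP LEMMA with slopes, for the static path model behind `KPlusLogSqLaw.TropicalB`

Cell pub-symmetroid, seat conjb-2 (g21). A helper toward the crux `TropicalB`
(`Summit.ValiantsHypothesis.ValiantsHypothesis.Theses.KPlusLogSqLaw.TropicalB`, item
`stmt-ValiantsHypothesis-19771`); it earns no crux credit and is not evidence for `MatrixDescartes` or for
Valiant's hypothesis.

This file reads the incompatible pair produced by `KPlusLogSqLawStepPair.step_pair` through
`KPlusLogSqLawStepPair.two_halfLines_disjoint` when the reach `d` is odd (the case of the HullDComb model rung, where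
the reach of a row is always odd), separately for an even and for an odd first line `i`:

* `step_slopes_even` : `i` even. A step from the window `[i, i+d]` to `[i+1, i+d+1]` forces two odd lines
  `o, o'` of `[i+1, i+d]` with either `s i < s o`, `s o' < s (i+d+1)` and every separation point of `[i, i+d]` to
  the left of every separation point of `[i+1, i+d+1]`, or the mirror image `s o < s i`, `s (i+d+1) < s o'` with
  the order of the separation points reversed.
* `step_slopes_odd` : `i` odd. The same with two even lines `e, e'` of `[i+1, i+d]`: either `s e < s i`,
  `s (i+d+1) < s e'` and `[i, i+d]` separates to the left of `[i+1, i+d+1]`, or the mirror image.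

For `d = 3`, `i = 0` this is the skeleton of LEMMA S3 (`KPlusLogSqLawReachThreeStep.reach3_step_forces`, which
sharpens it using the reach-three slope hypotheses); for `d ≥ 5` it is the entry point of the step analysis that
the suffix induction of THEORY-NOTE-g21 §5 still lacks.
-/

set_option linter.dupNamespace false

namespace Summit.ValiantsHypothesis.ValiantsHypothesis.Theorems.KPlusLogSqLawStepSlopes

open Summit.ValiantsHypothesis.ValiantsHypothesis.Theorems.KPlusLogSqLawStepPair (step_pair two_halfLines_disjoint)

/-- STEP LEMMA with slopes, even first line. -/
theorem step_slopes_even (s b : ℕ → ℝ) (i d : ℕ) (hi : Even i) (hd : Odd d)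
    (hA : ∃ θ : ℝ, ∀ e o : ℕ, i ≤ e → e ≤ i + d → i ≤ o → o ≤ i + d → Even e → Odd o →
      b o + s o * θ < b e + s e * θ)
    (hB : ∃ θ : ℝ, ∀ e o : ℕ, i + 1 ≤ e → e ≤ i + d + 1 → i + 1 ≤ o → o ≤ i + d + 1 → Even e → Odd o →
      b o + s o * θ < b e + s e * θ)
    (hAB : ∀ θ : ℝ, ¬ ((∀ e o : ℕ, i ≤ e → e ≤ i + d → i ≤ o → o ≤ i + d → Even e → Odd o →
      b o + s o * θ < b e + s e * θ) ∧ (∀ e o : ℕ, i + 1 ≤ e → e ≤ i + d + 1 → i + 1 ≤ o → o ≤ i + d + 1 →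
      Even e → Odd o → b o + s o * θ < b e + s e * θ))) :
    ∃ o o' : ℕ, Odd o ∧ Odd o' ∧ i + 1 ≤ o ∧ o ≤ i + d ∧ i + 1 ≤ o' ∧ o' ≤ i + d ∧
      ((s i < s o ∧ s o' < s (i + d + 1) ∧
          ∀ θ θ' : ℝ, (∀ e o : ℕ, i ≤ e → e ≤ i + d → i ≤ o → o ≤ i + d → Even e → Odd o →
            b o + s o * θ < b e + s e * θ) →
            (∀ e o : ℕ, i + 1 ≤ e → e ≤ i + d + 1 → i + 1 ≤ o → o ≤ i + d + 1 → Even e → Odd o →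
              b o + s o * θ' < b e + s e * θ') → θ < θ') ∨
        (s o < s i ∧ s (i + d + 1) < s o' ∧
          ∀ θ θ' : ℝ, (∀ e o : ℕ, i ≤ e → e ≤ i + d → i ≤ o → o ≤ i + d → Even e → Odd o →
            b o + s o * θ < b e + s e * θ) →
            (∀ e o : ℕ, i + 1 ≤ e → e ≤ i + d + 1 → i + 1 ≤ o → o ≤ i + d + 1 → Even e → Odd o →
              b o + s o * θ' < b e + s e * θ') → θ' < θ)) := by
  obtain ⟨θA, hθA⟩ := hA
  obtain ⟨θB, hθB⟩ := hB
  obtain ⟨e, o, e', o', ⟨he, ho, h1, h2, h3, h4, hpi⟩, ⟨ge, go, g1, g2, g3, g4, hqi⟩, hinc⟩ :=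
    step_pair s b i d ⟨θA, hθA⟩ ⟨θB, hθB⟩ hAB
  have hi2 := Nat.even_iff.mp hi
  have hd2 := Nat.odd_iff.mp hd
  have he2 := Nat.even_iff.mp he
  have ho2 := Nat.odd_iff.mp ho
  have ge2 := Nat.even_iff.mp ge
  have go2 := Nat.odd_iff.mp go
  have hei : e = i := by omega
  have hei' : e' = i + d + 1 := by omega
  subst hei hei'
  -- the two comparisons as affine functions
  have hx : 0 < (b e - b o) + (s e - s o) * θA := by
    have := hθA e o h1 h2 h3 h4 he ho
    linarith
  have hy : 0 < (b (e + d + 1) - b o') + (s (e + d + 1) - s o') * θB := by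
    have := hθB (e + d + 1) o' g1 g2 g3 g4 ge go
    linarith
  have hdis : ∀ θ : ℝ, ¬ (0 < (b e - b o) + (s e - s o) * θ ∧
      0 < (b (e + d + 1) - b o') + (s (e + d + 1) - s o') * θ) := by
    intro θ hθ
    apply hinc θ
    constructor
    · linarith [hθ.1]
    · linarith [hθ.2]
  refine ⟨o, o', ho, go, by omega, h4, g3, by omega, ?_⟩
  rcases two_halfLines_disjoint _ _ _ _ θA θB hx hy hdis with ⟨f1, f2, f3⟩ | ⟨f1, f2, f3⟩
  · refine Or.inl ⟨by linarith, by linarith, ?_⟩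
    intro θ θ' hθ hθ'
    apply f3 θ θ'
    · have := hθ e o h1 h2 h3 h4 he ho
      linarith
    · have := hθ' (e + d + 1) o' g1 g2 g3 g4 ge go
      linarith
  · refine Or.inr ⟨by linarith, by linarith, ?_⟩
    intro θ θ' hθ hθ'
    apply f3 θ θ'
    · have := hθ e o h1 h2 h3 h4 he ho
      linarith
    · have := hθ' (e + d + 1) o' g1 g2 g3 g4 ge go
      linarith

/-- STEP LEMMA with slopes, odd first line. -/
theorem step_slopes_odd (s b : ℕ → ℝ) (i d : ℕ) (hi : Odd i) (hd : Odd d)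
    (hA : ∃ θ : ℝ, ∀ e o : ℕ, i ≤ e → e ≤ i + d → i ≤ o → o ≤ i + d → Even e → Odd o →
      b o + s o * θ < b e + s e * θ)
    (hB : ∃ θ : ℝ, ∀ e o : ℕ, i + 1 ≤ e → e ≤ i + d + 1 → i + 1 ≤ o → o ≤ i + d + 1 → Even e → Odd o →
      b o + s o * θ < b e + s e * θ)
    (hAB : ∀ θ : ℝ, ¬ ((∀ e o : ℕ, i ≤ e → e ≤ i + d → i ≤ o → o ≤ i + d → Even e → Odd o →
      b o + s o * θ < b e + s e * θ) ∧ (∀ e o : ℕ, i + 1 ≤ e → e ≤ i + d + 1 → i + 1 ≤ o → o ≤ i + d + 1 →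
      Even e → Odd o → b o + s o * θ < b e + s e * θ))) :
    ∃ e e' : ℕ, Even e ∧ Even e' ∧ i + 1 ≤ e ∧ e ≤ i + d ∧ i + 1 ≤ e' ∧ e' ≤ i + d ∧
      ((s e < s i ∧ s (i + d + 1) < s e' ∧
          ∀ θ θ' : ℝ, (∀ e o : ℕ, i ≤ e → e ≤ i + d → i ≤ o → o ≤ i + d → Even e → Odd o →
            b o + s o * θ < b e + s e * θ) →
            (∀ e o : ℕ, i + 1 ≤ e → e ≤ i + d + 1 → i + 1 ≤ o → o ≤ i + d + 1 → Even e → Odd o →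
              b o + s o * θ' < b e + s e * θ') → θ < θ') ∨
        (s i < s e ∧ s e' < s (i + d + 1) ∧
          ∀ θ θ' : ℝ, (∀ e o : ℕ, i ≤ e → e ≤ i + d → i ≤ o → o ≤ i + d → Even e → Odd o →
            b o + s o * θ < b e + s e * θ) →
            (∀ e o : ℕ, i + 1 ≤ e → e ≤ i + d + 1 → i + 1 ≤ o → o ≤ i + d + 1 → Even e → Odd o →
              b o + s o * θ' < b e + s e * θ') → θ' < θ)) := by
  obtain ⟨θA, hθA⟩ := hA
  obtain ⟨θB, hθB⟩ := hB
  obtain ⟨e, o, e', o', ⟨he, ho, h1, h2, h3, h4, hpi⟩, ⟨ge, go, g1, g2, g3, g4, hqi⟩, hinc⟩ :=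
    step_pair s b i d ⟨θA, hθA⟩ ⟨θB, hθB⟩ hAB
  have hi2 := Nat.odd_iff.mp hi
  have hd2 := Nat.odd_iff.mp hd
  have he2 := Nat.even_iff.mp he
  have ho2 := Nat.odd_iff.mp ho
  have ge2 := Nat.even_iff.mp ge
  have go2 := Nat.odd_iff.mp go
  have hoi : o = i := by omega
  have hoi' : o' = i + d + 1 := by omega
  subst hoi hoi'
  have hx : 0 < (b e - b o) + (s e - s o) * θA := by
    have := hθA e o h1 h2 h3 h4 he ho
    linarith
  have hy : 0 < (b e' - b (o + d + 1)) + (s e' - s (o + d + 1)) * θB := by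
    have := hθB e' (o + d + 1) g1 g2 g3 g4 ge go
    linarith
  have hdis : ∀ θ : ℝ, ¬ (0 < (b e - b o) + (s e - s o) * θ ∧
      0 < (b e' - b (o + d + 1)) + (s e' - s (o + d + 1)) * θ) := by
    intro θ hθ
    apply hinc θ
    constructor
    · linarith [hθ.1]
    · linarith [hθ.2]
  refine ⟨e, e', he, ge, by omega, h2, g1, by omega, ?_⟩
  rcases two_halfLines_disjoint _ _ _ _ θA θB hx hy hdis with ⟨f1, f2, f3⟩ | ⟨f1, f2, f3⟩
  · refine Or.inl ⟨by linarith, by linarith, ?_⟩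
    intro θ θ' hθ hθ'
    apply f3 θ θ'
    · have := hθ e o h1 h2 h3 h4 he ho
      linarith
    · have := hθ' e' (o + d + 1) g1 g2 g3 g4 ge go
      linarith
  · refine Or.inr ⟨by linarith, by linarith, ?_⟩
    intro θ θ' hθ hθ'
    apply f3 θ θ'
    · have := hθ e o h1 h2 h3 h4 he ho
      linarith
    · have := hθ' e' (o + d + 1) g1 g2 g3 g4 ge go
      linarith

end Summit.ValiantsHypothesis.ValiantsHypothesis.Theorems.KPlusLogSqLawStepSlopes
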